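import Summits.NavierStokesRegularity.NavierStokesRegularity.Theorems.ExtremiserTransienceNearExtremalTransienceExtremiserLiouvilleConstantSpeedMultiplierExtension
import Summits.NavierStokesRegularity.NavierStokesRegularity.Theorems.ExtremiserTransienceNearExtremalTransienceExtremiserLiouvilleNewtonVectorPotential
import HarnessLib

/-!
# Crux `ExtremiserTransience.NearExtremalTransience` (stmt-NavierStokesRegularity-21883), line `extremiser_liouville`,
# stub K1b — TOOLS for the blow-down vorticity law: gradients are annihilated, `curl curl N[B] = ∇N[div B] − B`,
# `a₁(Ψ_B(R⁻¹·)) = −R⁻¹∫⟪ω, B(R⁻¹·)⟫`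

`--supports stmt-NavierStokesRegularity-21883` (helper).  Author: prover seat `ns-el-k1b` (g6).  Tools for
`…ConstantSpeedBlowDownVorticity` (record `Lines/extremiser_liouville_k1b_jet.md` §6, step (J2)): the test field
`Ψ_B = curl N[B]` (`N = Γ ∗ ·`, `B ∈ C_c^∞`, `…NewtonVectorPotential`) has `curl Ψ_B = ∇N[div B] − B`, and the gradient of the
zero-mean potential `N[div B]` is annihilated by an `L²` vorticity, so `a₁(Ψ_B(R⁻¹·)) = −R⁻¹∫⟪curl v x, B(R⁻¹x)⟫dx`.

* `integral_fderiv_apply_curl_eq_zero` : `∫ DΘ(x)(curl v x) dx = 0` for `Θ ∈ C^∞`, `|Θ|, ‖DΘ‖ ≲ (1+‖x‖)⁻²`, `curl v ∈ L²`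
  (weak divergence-freeness of `curl v` on the truncations `χ_ρΘ`, dominated convergence).
* `curl_curl_vecNewton` : `curl curl N[B](y) = Σᵢ ∂ᵢN[div B](y) eᵢ − B(y)`.
* `A1_vecNewton_rescale` : `a₁(Ψ_B(R⁻¹·)) = −R⁻¹∫⟪curl v x, B(R⁻¹x)⟫dx` (`v ∈ C²`, `curl v ∈ L²`, `R ≥ 1`).

WHAT THIS IS NOT: K1b is NOT proved; nothing here proves NS regularity. [folklore]
-/

noncomputable section

open Set Filter Topology MeasureTheory Metric Function
open scoped ENNReal NNReal Topology InnerProductSpace RealInnerProductSpace ContDiff Laplacian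
open Literature.Analysis.FluidPDE Literature.Analysis

namespace Summit.NavierStokesRegularity.NavierStokesRegularity.Theorems

-- the problem directory repeats the summit name (`NavierStokesRegularity/NavierStokesRegularity`)
set_option linter.dupNamespace false

namespace ExtremiserLiouville

open DepletionLadder.KStar DepletionLadder.KStar.HalfSpace
open Summit.NavierStokesRegularity.NavierStokesRegularity.Theorems.RungReynoldsOne.WeightedSlice

variable {v B : E3 → E3}

/-! ## Decaying gradients are annihilated by an `L²` vorticity -/

/-- For `v ∈ C²` with `curl v ∈ L²` and `Θ ∈ C^∞` with `|Θ|, ‖DΘ‖ ≤ C(1+‖x‖)⁻²`: `∫ DΘ(x)(curl v x) dx = 0` (weak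
divergence-freeness of `curl v` tested against the truncations `χ_ρ Θ`, dominated convergence). [folklore] -/
theorem integral_fderiv_apply_curl_eq_zero (hv : ContDiff ℝ 2 v) (hZ : Integrable (fun x => ‖curl v x‖ ^ 2) volume)
    {Θ : E3 → ℝ} (hΘ : ContDiff ℝ ∞ Θ) {C : ℝ} (hΘ0 : ∀ x, |Θ x| ≤ C * ((1 + ‖x‖) ^ 2)⁻¹)
    (hΘ1 : ∀ x, ‖fderiv ℝ Θ x‖ ≤ C * ((1 + ‖x‖) ^ 2)⁻¹) :
    ∫ x, fderiv ℝ Θ x (curl v x) = 0 := by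
  obtain ⟨Cχ, hCχ0, hCχ⟩ := exists_norm_fderiv_cutoff_le (E := E3)
  have hC0 : 0 ≤ C := by
    have h := hΘ0 0
    have : 0 < ((1 + ‖(0 : E3)‖) ^ 2)⁻¹ := by positivity
    nlinarith [abs_nonneg (Θ 0)]
  set E : E3 → ℝ := fun x => ((1 + ‖x‖) ^ 2)⁻¹ with hE
  have hE0 : ∀ x, 0 ≤ E x := fun x => by positivity
  have hdiv : IsWeaklyDivFree (curl v) := isWeaklyDivFree_curl (hv.of_le (by norm_num))
  have hρ0 : ∀ n : ℕ, (0 : ℝ) < (n : ℝ) + 1 := fun n => by positivity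
  have hρ1 : ∀ n : ℕ, (1 : ℝ) ≤ (n : ℝ) + 1 := fun n => by simp
  set θ : ℕ → E3 → ℝ := fun n x => cutoff ((n : ℝ) + 1) x * Θ x with hθ
  have hθs : ∀ n, ContDiff ℝ ∞ (θ n) := fun n => (contDiff_cutoff _).mul hΘ
  have hθc : ∀ n, HasCompactSupport (θ n) := fun n => (hasCompactSupport_cutoff (hρ0 n)).mul_right
  have hzero : ∀ n, ∫ x, fderiv ℝ (θ n) x (curl v x) = 0 := fun n => by
    have h := hdiv (θ n) ⟨hθs n, hθc n, fun _ _ => trivial⟩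
    rw [← h]
    refine integral_congr_ae (Eventually.of_forall fun x => ?_)
    show fderiv ℝ (θ n) x (curl v x) = ⟪curl v x, gradient (θ n) x⟫_ℝ
    rw [← inner_gradient_left, real_inner_comm]
  have hdc : ∀ n, Differentiable ℝ (cutoff (E := E3) ((n : ℝ) + 1)) := fun n =>
    (contDiff_cutoff (n := 1) _).differentiable one_ne_zero
  have hdΘ : Differentiable ℝ Θ := hΘ.differentiable (by simp)
  have hgrad : ∀ n x, fderiv ℝ (θ n) x = cutoff ((n : ℝ) + 1) x • fderiv ℝ Θ x + Θ x • fderiv ℝ (cutoff ((n : ℝ) + 1)) x :=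
    fun n x => by rw [hθ]; exact fderiv_fun_mul (hdc n x) (hdΘ x)
  have hcv : Continuous (curl v) := continuous_curl (hv.of_le (by norm_num))
  -- dominated convergence
  have hlim : Tendsto (fun n => ∫ x, fderiv ℝ (θ n) x (curl v x)) atTop (𝓝 (∫ x, fderiv ℝ Θ x (curl v x))) := by
    refine tendsto_integral_of_dominated_convergence (fun x => (‖curl v x‖ ^ 2 + (C * (1 + Cχ) * E x) ^ 2) / 2)
      (fun n => ?_) ((hZ.add ((integrable_inv_one_add_norm_sq_sq.const_mul ((C * (1 + Cχ)) ^ 2)).congr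
        (Eventually.of_forall fun x => by simp only [hE]; ring))).div_const 2)
      (fun n => Eventually.of_forall fun x => ?_) ?_
    · exact (((hθs n).continuous_fderiv (by simp)).clm_apply hcv).aestronglyMeasurable
    · have h1 : ‖fderiv ℝ (θ n) x‖ ≤ C * (1 + Cχ) * E x := by
        rw [hgrad]
        refine (norm_add_le _ _).trans ?_
        rw [norm_smul, norm_smul, Real.norm_eq_abs, Real.norm_eq_abs]
        have ha : |cutoff ((n : ℝ) + 1) x| * ‖fderiv ℝ Θ x‖ ≤ 1 * (C * E x) :=
          mul_le_mul (abs_cutoff_le_one _ x) (hΘ1 x) (norm_nonneg _) zero_le_one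
        have hb : |Θ x| * ‖fderiv ℝ (cutoff ((n : ℝ) + 1)) x‖ ≤ (C * E x) * Cχ := by
          refine mul_le_mul (hΘ0 x) ((hCχ _ (hρ0 n) x).trans (div_le_self hCχ0 (hρ1 n))) (norm_nonneg _) ?_
          exact mul_nonneg hC0 (hE0 x)
        nlinarith [ha, hb]
      rw [Real.norm_eq_abs]
      calc |fderiv ℝ (θ n) x (curl v x)| ≤ ‖fderiv ℝ (θ n) x‖ * ‖curl v x‖ := by
            rw [← Real.norm_eq_abs]; exact (fderiv ℝ (θ n) x).le_opNorm _
        _ ≤ (C * (1 + Cχ) * E x) * ‖curl v x‖ := mul_le_mul_of_nonneg_right h1 (norm_nonneg _)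
        _ ≤ (‖curl v x‖ ^ 2 + (C * (1 + Cχ) * E x) ^ 2) / 2 := by
            nlinarith [sq_nonneg (‖curl v x‖ - C * (1 + Cχ) * E x)]
    · refine Eventually.of_forall fun x => tendsto_const_nhds.congr' ?_
      filter_upwards [tendsto_natCast_atTop_atTop.eventually_gt_atTop ‖x‖] with n hn
      have hev : θ n =ᶠ[𝓝 x] Θ := by
        have hU : ball (0 : E3) ((n : ℝ) + 1) ∈ 𝓝 x := isOpen_ball.mem_nhds (by rw [mem_ball_zero_iff]; linarith)
        filter_upwards [hU] with y hy
        show cutoff ((n : ℝ) + 1) y * Θ y = Θ y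
        rw [cutoff_eq_one (hρ0 n) (mem_ball_zero_iff.1 hy).le, one_mul]
      rw [hev.fderiv_eq]
  have h0 : Tendsto (fun n => ∫ x, fderiv ℝ (θ n) x (curl v x)) atTop (𝓝 0) := by
    simp_rw [hzero]; exact tendsto_const_nhds
  exact tendsto_nhds_unique hlim h0

/-! ## The test field `Ψ_B = curl N[B]`: `curl Ψ_B = ∇N[div B] − B` -/

/-- The divergence of a test field is a scalar test function with zero mean. [folklore] -/
theorem testFunction_divergence (hB : ContDiff ℝ ∞ B) (hBc : HasCompactSupport B) :
    ContDiff ℝ (⊤ : ℕ∞) (VectorCalculus.divergence B) ∧ HasCompactSupport (VectorCalculus.divergence B) ∧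
      ∫ x, VectorCalculus.divergence B x = 0 := by
  refine ⟨contDiff_divergence (n := ⊤) (hB.of_le (by exact_mod_cast le_top)), ?_,
    integral_divergence_eq_zero (hB.of_le (by norm_cast)) hBc⟩
  exact hBc.mono' fun x hx => by
    contrapose! hx
    exact notMem_support.2 (divergence_eq_zero_of_notMem_tsupport hx)

/-- **`curl curl N[B](y) = Σᵢ ∂ᵢN[div B](y) eᵢ − B(y)`** (`curl N[B] = N[curl B]`, `curl curl B = ∇div B − ΔB` pointwise on the
test field, `N[ΔB] = B`, and the derivative falls on the test function in `N[∂ᵢ div B] = ∂ᵢ N[div B]`). [folklore] -/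
theorem curl_curl_vecNewton (hB : ContDiff ℝ ∞ B) (hBc : HasCompactSupport B) (y : E3) :
    curl (curl (fun y => ∫ x, newtonKernel (y - x) • B x)) y =
      (∑ i : Fin 3, (fderiv ℝ (fun y => ∫ x, newtonKernel (y - x) * VectorCalculus.divergence B x) y
          (EuclideanSpace.single i (1 : ℝ))) • EuclideanSpace.single i (1 : ℝ)) - B y := by
  obtain ⟨hdivs, hdivc, -⟩ := testFunction_divergence hB hBc
  have hcB : ContDiff ℝ (⊤ : ℕ∞) (curl B) := contDiff_curl (n := ⊤) (by exact_mod_cast hB)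
  have hcBc : HasCompactSupport (curl B) := hasCompactSupport_curl hBc
  have hcurlA : curl (fun y => ∫ x, newtonKernel (y - x) • B x) = fun y => ∫ x, newtonKernel (y - x) • curl B x :=
    funext (curl_vecNewton hB hBc)
  rw [hcurlA, curl_vecNewton hcB hcBc y]
  -- `curl curl B = G − ΔB`
  set G : E3 → E3 := fun x => ∑ i : Fin 3, (fderiv ℝ (VectorCalculus.divergence B) x (EuclideanSpace.single i (1 : ℝ))) •
    EuclideanSpace.single i (1 : ℝ) with hG
  have hcc : ∀ x, curl (curl B) x = G x - (Δ B) x := fun x =>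
    curl_curl_eq_sum_fderiv_divergence_sub_laplacian (hB.of_le (by norm_cast)) x
  have hGc : Continuous G := continuous_finsetSum _ fun i _ =>
    ((hdivs.continuous_fderiv (by simp)).clm_apply continuous_const).smul continuous_const
  have hGs : HasCompactSupport G := by
    refine (hdivc.fderiv (𝕜 := ℝ)).mono' fun x hx => ?_
    contrapose! hx
    have h0 : fderiv ℝ (VectorCalculus.divergence B) x = 0 := image_eq_zero_of_notMem_tsupport hx
    refine notMem_support.2 ?_
    simp [hG, h0]
  have hΔc : Continuous (Δ B) := (contDiff_laplacian (n := 0) (by exact hB.of_le (by norm_cast))).continuous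
  have hΔs : HasCompactSupport (Δ B) :=
    HasCompactSupport.of_support_subset_isCompact hBc.isCompact fun y hy => by
      by_contra h
      exact hy (laplacian_eq_zero_of_notMem_tsupport h)
  have IG : Integrable fun x => newtonKernel (y - x) • G x := integrable_newtonKernel_smul hGc hGs y
  have IΔ : Integrable fun x => newtonKernel (y - x) • (Δ B) x := integrable_newtonKernel_smul hΔc hΔs y
  have hsplit : (∫ x, newtonKernel (y - x) • curl (curl B) x) =
      (∫ x, newtonKernel (y - x) • G x) - ∫ x, newtonKernel (y - x) • (Δ B) x := by
    rw [← integral_sub IG IΔ]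
    exact integral_congr_ae (Eventually.of_forall fun x => by simp only [hcc, smul_sub])
  rw [hsplit, integral_newtonKernel_smul_laplacian (hB.of_le (by norm_cast)) hBc y]
  congr 1
  -- `N[G](y) = Σᵢ ∂ᵢ N[div B](y) eᵢ`
  have h := congrFun (vecNewton_eq_sum hGc hGs) y
  simp only at h
  rw [h]
  refine Finset.sum_congr rfl fun i _ => ?_
  congr 1
  rw [fderiv_integral_newtonKernel_mul_apply hdivs hdivc y]
  refine integral_congr_ae (Eventually.of_forall fun x => ?_)
  have e : G x i = fderiv ℝ (VectorCalculus.divergence B) x (EuclideanSpace.single i (1 : ℝ)) := by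
    simp only [hG]; fin_cases i <;> simp [Fin.sum_univ_three]
  simp only [e]

/-! ## `a₁(Ψ_B(R⁻¹·)) = −R⁻¹∫⟪ω, B(R⁻¹·)⟫` -/

/-- `((1+‖R⁻¹x‖)²)⁻¹ ≤ R²((1+‖x‖)²)⁻¹` for `R ≥ 1`. [folklore] -/
theorem inv_sq_rescale_le {R : ℝ} (hR : 1 ≤ R) (x : E3) : ((1 + ‖R⁻¹ • x‖) ^ 2)⁻¹ ≤ R ^ 2 * ((1 + ‖x‖) ^ 2)⁻¹ := by
  have hR0 : 0 < R := lt_of_lt_of_le one_pos hR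
  have hx : 0 < 1 + ‖x‖ := by positivity
  have h1 : 1 + ‖x‖ ≤ R * (1 + ‖R⁻¹ • x‖) := by
    rw [norm_smul, Real.norm_eq_abs, abs_of_pos (inv_pos.2 hR0), mul_add, mul_one, ← mul_assoc, mul_inv_cancel₀ hR0.ne',
      one_mul]
    linarith [norm_nonneg x]
  have h2 : (1 + ‖x‖) ^ 2 ≤ R ^ 2 * (1 + ‖R⁻¹ • x‖) ^ 2 := by rw [← mul_pow]; exact pow_le_pow_left₀ hx.le h1 2
  rw [← div_eq_mul_inv, le_div_iff₀ (by positivity)]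
  calc ((1 + ‖R⁻¹ • x‖) ^ 2)⁻¹ * (1 + ‖x‖) ^ 2 ≤ ((1 + ‖R⁻¹ • x‖) ^ 2)⁻¹ * (R ^ 2 * (1 + ‖R⁻¹ • x‖) ^ 2) :=
        mul_le_mul_of_nonneg_left h2 (by positivity)
    _ = R ^ 2 := by field_simp

/-- **`a₁(Ψ_B(R⁻¹·)) = −R⁻¹ ∫⟪curl v x, B(R⁻¹x)⟫dx`** for `Ψ_B = curl N[B]`, `v ∈ C²` with `curl v ∈ L²`, `R ≥ 1`
(`curl Ψ_B = ∇N[div B] − B`; the gradient of the zero-mean potential `N[div B]`, `|·| ≲ (1+‖y‖)⁻²`, `‖D·‖ ≲ (1+‖y‖)⁻²`,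
is annihilated by `curl v`). [folklore] -/
theorem A1_vecNewton_rescale (hv : ContDiff ℝ 2 v) (hZ : Integrable (fun x => ‖curl v x‖ ^ 2) volume)
    (hB : ContDiff ℝ ∞ B) (hBc : HasCompactSupport B) {R : ℝ} (hR : 1 ≤ R) :
    A1 v (fun y => curl (fun y => ∫ x, newtonKernel (y - x) • B x) (R⁻¹ • y)) =
      -(R⁻¹ * ∫ x, ⟪curl v x, B (R⁻¹ • x)⟫_ℝ) := by
  have hR0 : 0 < R := lt_of_lt_of_le one_pos hR
  obtain ⟨hdivs, hdivc, hdiv0⟩ := testFunction_divergence hB hBc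
  set A : E3 → E3 := fun y => ∫ x, newtonKernel (y - x) • B x with hA
  set q : E3 → ℝ := fun y => ∫ x, newtonKernel (y - x) * VectorCalculus.divergence B x with hq
  have hAs : ContDiff ℝ ∞ A := contDiff_vecNewton hB hBc
  have hΨd : Differentiable ℝ (curl A) := (contDiff_curl (n := ⊤) (by exact_mod_cast hAs)).differentiable (by simp)
  have hqs : ContDiff ℝ (⊤ : ℕ∞) q := contDiff_integral_newtonKernel_mul hdivs hdivc
  obtain ⟨C₀, hC₀0, hq0⟩ := exists_abs_newtonPotential_le_of_integral_eq_zero hdivs hdivc hdiv0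
  obtain ⟨C₁, hC₁0, hq1⟩ := exists_norm_fderiv_newtonPotential_le' hdivs hdivc
  -- the rescaled potential `Θ(x) = R q(R⁻¹x)`, `DΘ(x) = Dq(R⁻¹x)`
  set Θ : E3 → ℝ := fun x => R * q (R⁻¹ • x) with hΘ
  have hqd : Differentiable ℝ q := hqs.differentiable (by simp)
  have hΘs : ContDiff ℝ ∞ Θ := contDiff_const.mul (hqs.comp (contDiff_id.const_smul R⁻¹))
  have hDΘ : ∀ x, fderiv ℝ Θ x = fderiv ℝ q (R⁻¹ • x) := fun x => by
    have h1 : HasFDerivAt (fun x : E3 => q (R⁻¹ • x)) (R⁻¹ • fderiv ℝ q (R⁻¹ • x)) x := by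
      have hL : HasFDerivAt (fun x : E3 => R⁻¹ • x) (R⁻¹ • ContinuousLinearMap.id ℝ E3) x := (hasFDerivAt_id x).const_smul R⁻¹
      refine ((hqd (R⁻¹ • x)).hasFDerivAt.comp x hL).congr_fderiv ?_
      ext w; simp
    rw [hΘ, (h1.const_mul R).fderiv, smul_smul, mul_inv_cancel₀ hR0.ne', one_smul]
  have hΘ0 : ∀ x, |Θ x| ≤ C₀ * R ^ 3 * ((1 + ‖x‖) ^ 2)⁻¹ := fun x => by
    rw [hΘ, abs_mul, abs_of_pos hR0]
    calc R * |q (R⁻¹ • x)| ≤ R * (C₀ * ((1 + ‖R⁻¹ • x‖) ^ 2)⁻¹) := mul_le_mul_of_nonneg_left (hq0 _) hR0.le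
      _ ≤ R * (C₀ * (R ^ 2 * ((1 + ‖x‖) ^ 2)⁻¹)) :=
          mul_le_mul_of_nonneg_left (mul_le_mul_of_nonneg_left (inv_sq_rescale_le hR x) hC₀0) hR0.le
      _ = C₀ * R ^ 3 * ((1 + ‖x‖) ^ 2)⁻¹ := by ring
  have hΘ1 : ∀ x, ‖fderiv ℝ Θ x‖ ≤ C₁ * R ^ 3 * ((1 + ‖x‖) ^ 2)⁻¹ := fun x => by
    rw [hDΘ]
    calc ‖fderiv ℝ q (R⁻¹ • x)‖ ≤ C₁ * ((1 + ‖R⁻¹ • x‖) ^ 2)⁻¹ := hq1 _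
      _ ≤ C₁ * (R ^ 2 * ((1 + ‖x‖) ^ 2)⁻¹) := mul_le_mul_of_nonneg_left (inv_sq_rescale_le hR x) hC₁0
      _ ≤ C₁ * R ^ 3 * ((1 + ‖x‖) ^ 2)⁻¹ := by
          have : R ^ 2 ≤ R ^ 3 := pow_le_pow_right₀ hR (by norm_num)
          have h0 : 0 ≤ ((1 + ‖x‖) ^ 2)⁻¹ := by positivity
          nlinarith [mul_le_mul_of_nonneg_right this (mul_nonneg hC₁0 h0)]
  have hC : ∀ x, |Θ x| ≤ (C₀ + C₁) * R ^ 3 * ((1 + ‖x‖) ^ 2)⁻¹ ∧ ‖fderiv ℝ Θ x‖ ≤ (C₀ + C₁) * R ^ 3 * ((1 + ‖x‖) ^ 2)⁻¹ :=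
    fun x => by
    have h0 : 0 ≤ R ^ 3 * ((1 + ‖x‖) ^ 2)⁻¹ := by positivity
    constructor
    · refine (hΘ0 x).trans ?_; nlinarith
    · refine (hΘ1 x).trans ?_; nlinarith
  have hgrad := integral_fderiv_apply_curl_eq_zero hv hZ hΘs (fun x => (hC x).1) fun x => (hC x).2
  -- the pointwise identity `curl Ψ_R(x) = R⁻¹ (Σᵢ ∂ᵢq(R⁻¹x) eᵢ − B(R⁻¹x))`
  have hcurl : ∀ x, curl (fun y => curl A (R⁻¹ • y)) x =
      R⁻¹ • ((∑ i : Fin 3, (fderiv ℝ q (R⁻¹ • x) (EuclideanSpace.single i (1 : ℝ))) • EuclideanSpace.single i (1 : ℝ)) -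
        B (R⁻¹ • x)) := fun x => by
    rw [curl_rescale hΨd, curl_curl_vecNewton hB hBc]
  -- the gradient pairing is `DΘ(x)(curl v x)`
  have hinner : ∀ x, ⟪curl v x, ∑ i : Fin 3, (fderiv ℝ q (R⁻¹ • x) (EuclideanSpace.single i (1 : ℝ))) •
      EuclideanSpace.single i (1 : ℝ)⟫_ℝ = fderiv ℝ Θ x (curl v x) := fun x => by
    rw [hDΘ x]
    conv_rhs => rw [eq_sum_smul_single (curl v x)]
    rw [map_sum, inner_sum]
    refine Finset.sum_congr rfl fun i _ => ?_
    rw [map_smul, real_inner_smul_right, EuclideanSpace.inner_single_right, smul_eq_mul]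
    simp [mul_comm]
  -- integrability of the two pieces
  have hcv : Continuous (curl v) := continuous_curl (hv.of_le (by norm_num))
  have IB : Integrable (fun x => ⟪curl v x, B (R⁻¹ • x)⟫_ℝ) volume := by
    have hc : Continuous fun x => ⟪curl v x, B (R⁻¹ • x)⟫_ℝ := hcv.inner (hB.continuous.comp (continuous_const_smul R⁻¹))
    refine hc.integrable_of_hasCompactSupport ?_
    exact (hasCompactSupport_rescale hBc hR0.ne').mono' fun x hx => by
      contrapose! hx
      have : B (R⁻¹ • x) = 0 := image_eq_zero_of_notMem_tsupport (f := fun x => B (R⁻¹ • x)) hx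
      exact notMem_support.2 (by rw [this, inner_zero_right])
  have IG : Integrable (fun x => fderiv ℝ Θ x (curl v x)) volume := by
    have hc : Continuous fun x => fderiv ℝ Θ x (curl v x) := (hΘs.continuous_fderiv (by simp)).clm_apply hcv
    refine Integrable.mono' ((hZ.add ((integrable_inv_one_add_norm_sq_sq.const_mul (((C₀ + C₁) * R ^ 3) ^ 2)))).div_const 2)
      hc.aestronglyMeasurable (Eventually.of_forall fun x => ?_)
    rw [Real.norm_eq_abs]
    have h1 := (hC x).2
    calc |fderiv ℝ Θ x (curl v x)| ≤ ‖fderiv ℝ Θ x‖ * ‖curl v x‖ := by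
          rw [← Real.norm_eq_abs]; exact (fderiv ℝ Θ x).le_opNorm _
      _ ≤ ((C₀ + C₁) * R ^ 3 * ((1 + ‖x‖) ^ 2)⁻¹) * ‖curl v x‖ := mul_le_mul_of_nonneg_right h1 (norm_nonneg _)
      _ ≤ (‖curl v x‖ ^ 2 + ((C₀ + C₁) * R ^ 3) ^ 2 * (((1 + ‖x‖) ^ 2)⁻¹) ^ 2) / 2 := by
          nlinarith [sq_nonneg (‖curl v x‖ - (C₀ + C₁) * R ^ 3 * ((1 + ‖x‖) ^ 2)⁻¹)]
  unfold A1
  simp_rw [hcurl, inner_smul_right, inner_sub_right, hinner]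
  rw [integral_const_mul, integral_sub IG IB, hgrad, zero_sub, mul_neg]

end ExtremiserLiouville

end Summit.NavierStokesRegularity.NavierStokesRegularity.Theorems

end
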